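import Summits.Ventures.PercRepro.C025ProfileCases
import Summits.Ventures.PercRepro.C025ProfileStep
import Summits.Ventures.PercRepro.CoLoopDecomp

/-!
# PercRepro — C-032 PROFILE (Π): deleting a coloop — the lemmas of the `q = 1` coloop induction (night-3, gen 6)

Companion of `C025ProfileOne.lean` (which proves `(Π_{1,u})` for every simple matroid by induction on the coloops).
For a coloop `e` of a finite matroid `M` (and `M ＼ {e}` its deletion):

* prices of points: a coloop costs `[u+1 ≤ R]·C(R,u)/R` (`price_singleton_of_isColoop`; `ρ(E ∖ e) = R − 1`,
  `eRank_eq_eRk_diff_add_one_of_isColoop`), a non-coloop `[u ≤ R]·C(R+1,u)/(R+1)` (`price_singleton_of_not_isColoop'`);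
  on a simple matroid the right side of `(Π_{1,u})` is the closed form `T1 (ncol M) R (ccol M) u` (`sum_price_eq_T1`,
  `ncol` / `ccol` = the numbers of non-coloops / coloops);
* deleting a coloop keeps simplicity (`simple_delete`) and the other coloops (`isColoop_delete_iff_of_isColoop`,
  `ncol_delete_of_isColoop`, `ccol_delete_of_isColoop`), lowers the rank by one (`eRank_toNat_delete_of_isColoop`);
* **`card_levelSet_of_isColoop`** — the level decomposition `#levelSet M (u+1) = #levelSet (M＼e) (u+1) + #levelSet (M＼e) u`
  (`eRk_insert_of_isColoop`: adding a coloop raises the rank by one, `eRk_union_subset_coloops` of CoLoopDecomp);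
* structural facts: `isColoop_of_indep_ground`, `eRank_toNat_add_one_le_card_gr_of_not_isColoop` (a non-coloop forces
  `|E| ≥ ρ(E) + 1`), `closure_empty_of_simple`, `exists_other_not_isColoop` (a simple matroid never has exactly one
  non-coloop: `cl(coloops) = coloops`), `card_gr_le_one_of_eRank_one`.
-/

open scoped Matroid

namespace PercRepro

open Set Finset ThmH

section ProfileOneAll

variable {α : Type} {M : Matroid α}

/-- For a coloop `e ∈ E`: `ρ(E) = ρ(E ∖ {e}) + 1`. -/
theorem eRank_eq_eRk_diff_add_one_of_isColoop {e : α} (he : M.IsColoop e) :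
    M.eRank = M.eRk (M.E \ {e}) + 1 := by
  have heE : e ∈ M.E := he.mem_ground
  have h := eRk_union_subset_coloops (M := M) (X := M.E \ {e}) (K := {e}) Set.sdiff_subset
    (Set.singleton_subset_iff.2 he) Set.disjoint_sdiff_left
  rw [Set.sdiff_union_self, Set.union_eq_self_of_subset_right (Set.singleton_subset_iff.2 heE),
    Set.encard_singleton] at h
  rw [M.eRank_def, h]

variable [DecidableEq α] [M.Finite]

/-- The price of a coloop `e` at level `u`, with `R := ρ(E)`: `C(R,u)/R` if `u + 1 ≤ R`, else `0`. -/
theorem price_singleton_of_isColoop (u : ℕ) {e : α} (he : M.IsColoop e) :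
    Profile.price M 1 u ({e} : Finset α) =
      if u + 1 ≤ M.eRank.toNat then (Nat.choose M.eRank.toNat u : ℚ) / (M.eRank.toNat : ℚ) else 0 := by
  have hcoe : ((gr M \ ({e} : Finset α) : Finset α) : Set α) = M.E \ {e} := by
    rw [Finset.coe_sdiff, coe_gr, Finset.coe_singleton]
  have hRtop : M.eRank ≠ ⊤ := M.eRank_ne_top_iff.2 inferInstance
  have hR := eRank_eq_eRk_diff_add_one_of_isColoop he
  have hfin : M.eRk (M.E \ {e}) ≠ ⊤ := by
    intro h; rw [h] at hR; exact hRtop (by rw [hR]; rfl)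
  set R' := (M.eRk (M.E \ {e})).toNat with hR'
  have hRR' : M.eRank.toNat = R' + 1 := by
    rw [hR, ← ENat.coe_toNat hfin]; rfl
  unfold Profile.price
  rw [hcoe, ← ENat.coe_toNat hfin, ENat.toNat_coe, Nat.choose_one_right, hRR']
  by_cases hu : u ≤ R'
  · rw [if_pos (by exact_mod_cast hu), if_pos (by omega)]
  · rw [if_neg (by exact_mod_cast hu), if_neg (by omega)]

/-- The price of a non-coloop point `x` at level `u` (per-point version): `C(R+1,u)/(R+1)` if `u ≤ R`, else `0`. -/
theorem price_singleton_of_not_isColoop' (u : ℕ) {x : α} (hx : ¬ M.IsColoop x) :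
    Profile.price M 1 u ({x} : Finset α) =
      if u ≤ M.eRank.toNat then (Nat.choose (M.eRank.toNat + 1) u : ℚ) / (M.eRank.toNat + 1 : ℚ) else 0 := by
  have hcoe : ((gr M \ ({x} : Finset α) : Finset α) : Set α) = M.E \ {x} := by
    rw [Finset.coe_sdiff, coe_gr, Finset.coe_singleton]
  have hRtop : M.eRank ≠ ⊤ := M.eRank_ne_top_iff.2 inferInstance
  have hR : M.eRk (M.E \ {x}) = (M.eRank.toNat : ℕ∞) := by
    rw [eRk_ground_diff_singleton_of_not_isColoop hx, ENat.coe_toNat hRtop]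
  unfold Profile.price
  rw [hcoe, hR, ENat.toNat_coe, Nat.choose_one_right]
  by_cases hu : u ≤ M.eRank.toNat
  · rw [if_pos (by exact_mod_cast hu), if_pos hu]; push_cast; rfl
  · rw [if_neg (by exact_mod_cast hu), if_neg hu]

open scoped Classical in
/-- The number of non-coloops of `M`. -/
noncomputable def ncol (M : Matroid α) [M.Finite] : ℕ := ((gr M).filter (fun x => ¬ M.IsColoop x)).card

open scoped Classical in
/-- The number of coloops of `M`. -/
noncomputable def ccol (M : Matroid α) [M.Finite] : ℕ := ((gr M).filter (fun x => M.IsColoop x)).card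

open scoped Classical in
/-- On a simple matroid the right side of `(Π_{1,u})` is `T1 (ncol M) ρ(E) (ccol M) u`. -/
theorem sum_price_eq_T1 (hsimple : ∀ T ⊆ M.E, T.encard ≤ 2 → M.Indep T) (u : ℕ) :
    ∑ B ∈ Profile.Rq M 1, Profile.price M 1 u B = Profile.T1 (ncol M) M.eRank.toNat (ccol M) u := by
  rw [Rq_one_eq_image_singleton hsimple, Finset.sum_image (fun x _ y _ h => Finset.singleton_injective h)]
  rw [← Finset.sum_filter_add_sum_filter_not (gr M) (fun x => M.IsColoop x)]
  rw [Finset.sum_congr rfl (fun x hx => price_singleton_of_isColoop u (Finset.mem_filter.1 hx).2)]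
  rw [Finset.sum_congr rfl (fun x hx => price_singleton_of_not_isColoop' u (Finset.mem_filter.1 hx).2)]
  rw [Finset.sum_const, Finset.sum_const, nsmul_eq_mul, nsmul_eq_mul]
  unfold Profile.T1 Profile.T ncol ccol
  set R := M.eRank.toNat
  by_cases hu : u ≤ R
  · rw [if_pos hu, if_pos hu]
    ring
  · rw [if_neg hu, if_neg hu, if_neg (by omega)]
    simp


/-! ### Deleting a coloop: simplicity, coloops, rank, ground set -/

omit [DecidableEq α] [M.Finite] in
/-- Deleting an element preserves simplicity. -/
theorem simple_delete (hsimple : ∀ T ⊆ M.E, T.encard ≤ 2 → M.Indep T) (e : α) :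
    ∀ T ⊆ (M ＼ ({e} : Set α)).E, T.encard ≤ 2 → (M ＼ ({e} : Set α)).Indep T := by
  intro T hT h2
  rw [Matroid.delete_ground] at hT
  rw [Matroid.delete_indep_iff]
  refine ⟨hsimple T (hT.trans Set.sdiff_subset) h2, ?_⟩
  rw [Set.disjoint_singleton_right]
  intro he
  exact (hT he).2 rfl

omit [M.Finite] in
/-- For a coloop `e` and `x ≠ e`: `x` is a coloop of `M ＼ {e}` iff it is a coloop of `M`. -/
theorem isColoop_delete_iff_of_isColoop {e x : α} (he : M.IsColoop e) (hxe : x ≠ e) :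
    (M ＼ ({e} : Set α)).IsColoop x ↔ M.IsColoop x := by
  rw [Matroid.delete_isColoop_iff]
  constructor
  · rintro ⟨hcl, hxE, -⟩
    rw [M.isColoop_iff_notMem_closure_compl hxE]
    have hsplit : M.E \ {x} = (M.E \ {e}) \ {x} ∪ {e} := by
      ext y
      simp only [Set.mem_sdiff, Set.mem_singleton_iff, Set.mem_union]
      constructor
      · rintro ⟨hyE, hyx⟩
        by_cases hye : y = e
        · exact Or.inr hye
        · exact Or.inl ⟨⟨hyE, hye⟩, hyx⟩
      · rintro (⟨⟨hyE, _⟩, hyx⟩ | rfl)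
        · exact ⟨hyE, hyx⟩
        · exact ⟨he.mem_ground, fun h => hxe h.symm⟩
    rw [hsplit, Matroid.closure_union_eq_of_subset_coloops _ (Set.singleton_subset_iff.2 he)]
    rintro (h | h)
    · exact hcl h
    · exact hxe h
  · intro hx
    have hxE : x ∈ M.E := hx.mem_ground
    refine ⟨?_, hxE, fun h => hxe h⟩
    rw [M.isColoop_iff_notMem_closure_compl hxE] at hx
    intro hmem
    apply hx
    exact M.closure_subset_closure (Set.sdiff_subset_sdiff_left Set.sdiff_subset) hmem

omit [DecidableEq α] [M.Finite] in
/-- The rank of `M ＼ {e}` is `ρ(E ∖ {e})`. -/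
theorem eRank_delete_singleton (e : α) : (M ＼ ({e} : Set α)).eRank = M.eRk (M.E \ {e}) := by
  rw [Matroid.delete_eq_restrict, Matroid.eRank_restrict]

omit [DecidableEq α] in
/-- For a coloop `e`: `ρ(M) = ρ(M ＼ {e}) + 1` on `ℕ`. -/
theorem eRank_toNat_delete_of_isColoop {e : α} (he : M.IsColoop e) :
    M.eRank.toNat = (M ＼ ({e} : Set α)).eRank.toNat + 1 := by
  have hRtop : M.eRank ≠ ⊤ := M.eRank_ne_top_iff.2 inferInstance
  have h := eRank_eq_eRk_diff_add_one_of_isColoop he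
  rw [eRank_delete_singleton]
  have hfin : M.eRk (M.E \ {e}) ≠ ⊤ := by
    intro h'; rw [h'] at h; exact hRtop (by rw [h]; rfl)
  have : M.eRank = ((M.eRk (M.E \ {e})).toNat + 1 : ℕ) := by
    rw [h, ← ENat.coe_toNat hfin]; push_cast; rfl
  rw [this, ENat.toNat_coe]

/-! ### The level decomposition at a coloop and the coloop / non-coloop counts -/

/-- The ground finset of `M ＼ {e}` is `gr M` with `e` erased. -/
theorem gr_delete_singleton (e : α) : gr (M ＼ ({e} : Set α)) = (gr M).erase e := by
  apply Finset.coe_injective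
  rw [coe_gr, Finset.coe_erase, coe_gr, Matroid.delete_ground]

omit [DecidableEq α] in
/-- Ranks in `M ＼ {e}` of subsets avoiding `e` are ranks in `M`. -/
theorem eRk_delete_singleton_of_notMem {e : α} {S : Finset α} (hS : S ⊆ gr M) (he : e ∉ S) :
    (M ＼ ({e} : Set α)).eRk (S : Set α) = M.eRk (S : Set α) := by
  rw [Matroid.delete_eq_restrict, Matroid.restrict_eRk_eq]
  intro x hx
  refine ⟨by rw [← coe_gr]; exact_mod_cast hS hx, ?_⟩
  rw [Set.mem_singleton_iff]
  rintro rfl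
  exact he hx

/-- For a coloop `e ∉ S`, `S ⊆ E`: `ρ(S ∪ {e}) = ρ(S) + 1`. -/
theorem eRk_insert_of_isColoop {e : α} (he : M.IsColoop e) {S : Finset α} (hS : S ⊆ gr M) (heS : e ∉ S) :
    M.eRk ((insert e S : Finset α) : Set α) = M.eRk (S : Set α) + 1 := by
  have h := eRk_union_subset_coloops (M := M) (X := (S : Set α)) (K := {e})
    (by rw [← coe_gr]; exact_mod_cast hS) (Set.singleton_subset_iff.2 he)
    (Set.disjoint_singleton_right.2 (by exact_mod_cast heS))
  rw [Finset.coe_insert, Set.insert_eq, Set.union_comm, h, Set.encard_singleton]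

/-- **The level decomposition at a coloop**: for a coloop `e` and `u ≥ 1`,
`#{S : ρ(S) = u} = #{S ⊆ E∖e : ρ(S) = u} + #{S ⊆ E∖e : ρ(S) = u − 1}`. -/
theorem card_levelSet_of_isColoop {e : α} (he : M.IsColoop e) (u : ℕ) :
    (Shadow.levelSet M (u + 1)).card =
      (Shadow.levelSet (M ＼ ({e} : Set α)) (u + 1)).card + (Shadow.levelSet (M ＼ ({e} : Set α)) u).card := by
  classical
  have heE : e ∈ gr M := by rw [← Finset.mem_coe, coe_gr]; exact he.mem_ground
  -- split the level by membership of `e`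
  rw [← Finset.card_filter_add_card_filter_not (s := Shadow.levelSet M (u + 1)) (fun S => e ∈ S)]
  rw [add_comm]
  congr 1
  · -- sets avoiding e
    congr 1
    ext S
    simp only [Finset.mem_filter, Profile.mem_levelSet, gr_delete_singleton]
    constructor
    · rintro ⟨⟨hS, hr⟩, heS⟩
      refine ⟨?_, ?_⟩
      · intro x hx; rw [Finset.mem_erase]; exact ⟨fun h => heS (h ▸ hx), hS hx⟩
      · rw [eRk_delete_singleton_of_notMem hS heS]; exact hr
    · rintro ⟨hS, hr⟩
      have heS : e ∉ S := fun h => (Finset.mem_erase.1 (hS h)).1 rfl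
      have hS' : S ⊆ gr M := hS.trans (Finset.erase_subset _ _)
      refine ⟨⟨hS', ?_⟩, heS⟩
      rw [← eRk_delete_singleton_of_notMem hS' heS]; exact hr
  · -- sets containing e ↔ (erase e) sets of rank u in M ＼ {e}
    rw [← Finset.card_image_of_injOn (f := fun S => S.erase e)]
    · congr 1
      ext S'
      simp only [Finset.mem_image, Finset.mem_filter, Profile.mem_levelSet, gr_delete_singleton]
      constructor
      · rintro ⟨S, ⟨⟨hS, hr⟩, heS⟩, rfl⟩
        refine ⟨?_, ?_⟩
        · intro x hx
          rw [Finset.mem_erase] at hx ⊢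
          exact ⟨hx.1, hS hx.2⟩
        · have h1 : S = insert e (S.erase e) := (Finset.insert_erase heS).symm
          have hsub : S.erase e ⊆ gr M := (Finset.erase_subset _ _).trans hS
          have hne : e ∉ S.erase e := Finset.notMem_erase e S
          rw [eRk_delete_singleton_of_notMem hsub hne]
          have h2 := eRk_insert_of_isColoop he hsub hne
          rw [← h1, hr] at h2
          -- h2 : ↑(u+1) = ρ(S.erase e) + 1
          have h3 : ((u : ℕ) : ℕ∞) + 1 = M.eRk ((S.erase e : Finset α) : Set α) + 1 := by
            rw [← h2]; push_cast; rfl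
          exact (WithTop.add_right_cancel (ENat.coe_ne_top 1) h3).symm
      · rintro ⟨hS', hr⟩
        have heS' : e ∉ S' := fun h => (Finset.mem_erase.1 (hS' h)).1 rfl
        have hS'g : S' ⊆ gr M := hS'.trans (Finset.erase_subset _ _)
        refine ⟨insert e S', ⟨⟨Finset.insert_subset heE hS'g, ?_⟩, Finset.mem_insert_self _ _⟩,
          Finset.erase_insert heS'⟩
        rw [eRk_insert_of_isColoop he hS'g heS', ← eRk_delete_singleton_of_notMem hS'g heS', hr]
        push_cast; rfl
    · intro S hS S₂ hS₂ h
      simp only [Finset.coe_filter, Profile.mem_levelSet] at hS hS₂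
      simp only at h
      rw [← Finset.insert_erase hS.2, ← Finset.insert_erase hS₂.2, h]

open scoped Classical in
/-- Deleting a coloop keeps the non-coloops. -/
theorem ncol_delete_of_isColoop {e : α} (he : M.IsColoop e) : ncol (M ＼ ({e} : Set α)) = ncol M := by
  unfold ncol
  rw [gr_delete_singleton]
  have h1 : ((gr M).erase e).filter (fun x => ¬ (M ＼ ({e} : Set α)).IsColoop x) =
      ((gr M).erase e).filter (fun x => ¬ M.IsColoop x) := by
    apply Finset.filter_congr
    intro x hx
    rw [isColoop_delete_iff_of_isColoop he (Finset.mem_erase.1 hx).1]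
  rw [h1, Finset.filter_erase, Finset.erase_eq_of_notMem]
  rw [Finset.mem_filter]
  exact fun h => h.2 he

open scoped Classical in
/-- Deleting a coloop removes exactly one coloop. -/
theorem ccol_delete_of_isColoop {e : α} (he : M.IsColoop e) : ccol (M ＼ ({e} : Set α)) + 1 = ccol M := by
  unfold ccol
  rw [gr_delete_singleton]
  have h1 : ((gr M).erase e).filter (fun x => (M ＼ ({e} : Set α)).IsColoop x) =
      ((gr M).erase e).filter (fun x => M.IsColoop x) := by
    apply Finset.filter_congr
    intro x hx
    rw [isColoop_delete_iff_of_isColoop he (Finset.mem_erase.1 hx).1]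
  rw [h1, Finset.filter_erase]
  have heE : e ∈ (gr M).filter (fun x => M.IsColoop x) := by
    rw [Finset.mem_filter]
    exact ⟨by rw [← Finset.mem_coe, coe_gr]; exact he.mem_ground, he⟩
  rw [Finset.card_erase_of_mem heE]
  have : 1 ≤ ((gr M).filter (fun x => M.IsColoop x)).card := Finset.card_pos.2 ⟨e, heE⟩
  omega

omit [DecidableEq α] in
open scoped Classical in
/-- `|E| = ncol M + ccol M`. -/
theorem card_gr_eq_ncol_add_ccol : (gr M).card = ncol M + ccol M := by
  unfold ncol ccol
  rw [add_comm, Finset.card_filter_add_card_filter_not]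

omit [DecidableEq α] in
open scoped Classical in
/-- A coloop exists when `ccol M ≥ 1`. -/
theorem exists_isColoop_of_ccol_pos (h : 0 < ccol M) : ∃ e, M.IsColoop e := by
  unfold ccol at h
  obtain ⟨e, he⟩ := Finset.card_pos.1 h
  exact ⟨e, (Finset.mem_filter.1 he).2⟩

/-! ### Structural facts: when every point is a coloop, and when some point is not -/

omit [DecidableEq α] [M.Finite] in
/-- If the ground set is independent, every element is a coloop. -/
theorem isColoop_of_indep_ground (hE : M.Indep M.E) {x : α} (hx : x ∈ M.E) : M.IsColoop x := by
  rw [Matroid.isColoop_iff_forall_mem_isBase]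
  intro B hB
  have : B = M.E := hB.eq_of_subset_indep hE hB.subset_ground
  rw [this]; exact hx

omit [DecidableEq α] in
/-- A matroid with a non-coloop has `|E| ≥ ρ(E) + 1`. -/
theorem eRank_toNat_add_one_le_card_gr_of_not_isColoop {x : α} (hxE : x ∈ M.E) (hx : ¬ M.IsColoop x) :
    M.eRank.toNat + 1 ≤ (gr M).card := by
  by_contra hlt
  push Not at hlt
  have hRtop : M.eRank ≠ ⊤ := M.eRank_ne_top_iff.2 inferInstance
  have hle : M.E.encard ≤ M.eRank := by
    rw [← coe_gr, Set.encard_coe_eq_coe_finsetCard, ← ENat.coe_toNat hRtop]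
    exact_mod_cast (by omega : (gr M).card ≤ M.eRank.toNat)
  have hind : M.Indep M.E := by
    rw [Matroid.indep_iff_eRk_eq_encard_of_finite M.ground_finite, ← M.eRank_def]
    exact le_antisymm (M.eRank_le_encard_ground) hle
  exact hx (isColoop_of_indep_ground hind hxE)

omit [DecidableEq α] [M.Finite] in
/-- In a simple matroid the loops are absent: `closure ∅ = ∅`. -/
theorem closure_empty_of_simple (hsimple : ∀ T ⊆ M.E, T.encard ≤ 2 → M.Indep T) : M.closure ∅ = ∅ := by
  ext x
  simp only [Set.mem_empty_iff_false, iff_false]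
  intro hx
  have hxE : x ∈ M.E := M.closure_subset_ground _ hx
  have hind : M.Indep {x} := hsimple _ (Set.singleton_subset_iff.2 hxE) (by simp)
  exact (M.indep_singleton.1 hind).not_isLoop hx

omit [DecidableEq α] [M.Finite] in
/-- In a simple matroid a non-coloop `x` has another non-coloop: otherwise `x ∈ cl(coloops) = coloops`. -/
theorem exists_other_not_isColoop (hsimple : ∀ T ⊆ M.E, T.encard ≤ 2 → M.Indep T) {x : α} (hxE : x ∈ M.E)
    (hx : ¬ M.IsColoop x) : ∃ y ∈ M.E, y ≠ x ∧ ¬ M.IsColoop y := by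
  by_contra hcon
  push Not at hcon
  have hsub : M.E \ {x} ⊆ M.coloops := by
    intro y hy
    exact hcon y hy.1 hy.2
  have hmem : x ∈ M.closure (M.E \ {x}) := by
    by_contra h
    exact hx ((M.isColoop_iff_notMem_closure_compl hxE).2 h)
  have h2 : M.closure (M.E \ {x}) ⊆ M.closure M.coloops := M.closure_subset_closure hsub
  have h3 : M.closure M.coloops = M.coloops := by
    have := Matroid.closure_union_eq_of_subset_coloops (M := M) ∅ (Subset.refl M.coloops)
    rw [Set.empty_union, closure_empty_of_simple hsimple, Set.empty_union] at this
    exact this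
  rw [h3] at h2
  exact hx (h2 hmem)

omit [DecidableEq α] in
/-- A simple matroid of rank `1` has at most one point. -/
theorem card_gr_le_one_of_eRank_one (hsimple : ∀ T ⊆ M.E, T.encard ≤ 2 → M.Indep T) (hR : M.eRank.toNat = 1) :
    (gr M).card ≤ 1 := by
  by_contra hlt
  push Not at hlt
  obtain ⟨T, hT, hTc⟩ := Finset.exists_subset_card_eq (show 2 ≤ (gr M).card by omega)
  have hTE : (T : Set α) ⊆ M.E := by rw [← coe_gr]; exact_mod_cast hT
  have henc : (T : Set α).encard = 2 := by rw [Set.encard_coe_eq_coe_finsetCard, hTc]; rfl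
  have hind : M.Indep (T : Set α) := hsimple _ hTE henc.le
  have h1 : M.eRk (T : Set α) ≤ M.eRank := M.eRk_le_eRank _
  rw [hind.eRk_eq_encard, henc] at h1
  have hRtop : M.eRank ≠ ⊤ := M.eRank_ne_top_iff.2 inferInstance
  rw [← ENat.coe_toNat hRtop, hR] at h1
  exact absurd h1 (by decide)

end ProfileOneAll

end PercRepro
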